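import Summits.Ventures.PercRepro0.Basic

/-!
# Block L glue, kernel-checked: the finite-box structure of `{0 ↔ ∞}` (L2/G1) and measurability

Cell pub-perc-repro0, seat p2.  Against the definitions of `Basic.lean` this file proves

* `infCluster_eq_iInter` : `{|C(0)| = ∞} = ⋂ₙ A_n` with `A_n = Reach d n = {0 ↔ ∂Λ_n}` (G1(c)),
* `reach_antitone`       : `A_{n+1} ⊆ A_n` (G1(b)),
* `measurableSet_reach`, `measurableSet_infCluster` (G1(a)),
* `tendsto_reach`        : `P_p(A_n) → θ_d(p)` as `n → ∞` (G1(c)).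
-/

open MeasureTheory ProbabilityTheory

namespace Summit.Ventures.PercRepro0

variable {d : ℕ}

-- BEGIN BODY

/-! ### The sup-norm -/

/-- The sup-norm `‖x‖_∞ = max_i |x_i|` of a vertex, as a natural number. -/
def nrm (x : Vertex d) : ℕ := Finset.univ.sup fun i => (x i).natAbs

/-- Each coordinate is bounded by the sup-norm. -/
lemma natAbs_le_nrm (x : Vertex d) (i : Fin d) : (x i).natAbs ≤ nrm x :=
  Finset.le_sup (f := fun i => (x i).natAbs) (Finset.mem_univ i)

/-- `‖x‖_∞ ≤ n` iff every coordinate is bounded by `n`. -/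
lemma nrm_le_iff {x : Vertex d} {n : ℕ} : nrm x ≤ n ↔ ∀ i, (x i).natAbs ≤ n := by
  simp [nrm, Finset.sup_le_iff]

/-- The origin has sup-norm `0`. -/
@[simp] lemma nrm_zero : nrm (0 : Vertex d) = 0 := by simp [nrm]

/-- Moving along a bond changes the sup-norm by at most one (target vs source). -/
lemma nrm_tgt_le (b : Bond d) : nrm b.tgt ≤ nrm b.src + 1 := by
  rw [nrm_le_iff]
  intro j
  by_cases hj : j = b.2
  · subst hj
    simp only [Bond.tgt, Function.update_self]
    have h1 := Int.natAbs_add_le (b.1 b.2) 1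
    have h2 := natAbs_le_nrm b.1 b.2
    simp only [Int.natAbs_one] at h1
    exact h1.trans (Nat.add_le_add_right h2 1)
  · simp only [Bond.tgt, Function.update_of_ne hj]
    exact (natAbs_le_nrm b.1 j).trans (Nat.le_succ _)

/-- Moving along a bond changes the sup-norm by at most one (source vs target). -/
lemma nrm_src_le (b : Bond d) : nrm b.src ≤ nrm b.tgt + 1 := by
  rw [nrm_le_iff]
  intro j
  by_cases hj : j = b.2
  · subst hj
    have h1 : b.tgt b.2 = b.1 b.2 + 1 := by simp [Bond.tgt]
    have h2 := natAbs_le_nrm b.tgt b.2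
    rw [h1] at h2
    have h3 := Int.natAbs_add_le (b.1 b.2 + 1) (-1)
    simp only [add_neg_cancel_right, Int.natAbs_neg, Int.natAbs_one] at h3
    exact h3.trans (Nat.add_le_add_right h2 1)
  · have h1 : b.tgt j = b.1 j := by simp [Bond.tgt, Function.update_of_ne hj]
    have h2 := natAbs_le_nrm b.tgt j
    rw [h1] at h2
    exact h2.trans (Nat.le_succ _)

/-- Along an open bond the sup-norm grows by at most one. -/
lemma nrm_le_of_openAdj {ω : Config d} {x y : Vertex d} (h : OpenAdj ω x y) :
    nrm y ≤ nrm x + 1 := by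
  obtain ⟨b, -, ⟨h1, h2⟩ | ⟨h1, h2⟩⟩ := h
  · rw [← h1, ← h2]; exact nrm_tgt_le b
  · rw [← h1, ← h2]; exact nrm_src_le b

/-! ### Connections inside a box and the events `A_n` -/

/-- Adjacency by an open bond with both endpoints in the box `Λ_n = {‖x‖_∞ ≤ n}`. -/
def OpenAdjIn (n : ℕ) (ω : Config d) (x y : Vertex d) : Prop :=
  OpenAdj ω x y ∧ nrm x ≤ n ∧ nrm y ≤ n

/-- Connection by an open path all of whose vertices lie in `Λ_n`. -/
def ConnIn (n : ℕ) (ω : Config d) : Vertex d → Vertex d → Prop :=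
  Relation.ReflTransGen (OpenAdjIn n ω)

/-- The event `A_n = {0 ↔ ∂Λ_n}`: some vertex of sup-norm exactly `n` is joined to the origin by an
open path inside `Λ_n`.  (By `reach_of_conn` this is the same as "some open path from `0` ends in
`∂Λ_n`", the form of ROUTE-v1 §0.) -/
def Reach (d : ℕ) (n : ℕ) : Set (Config d) := {ω | ∃ y, nrm y = n ∧ ConnIn n ω 0 y}

/-- A connection inside a box is a connection. -/
lemma conn_of_connIn {n : ℕ} {ω : Config d} {x y : Vertex d} (h : ConnIn n ω x y) :
    Conn ω x y := by
  induction h with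
  | refl => exact Relation.ReflTransGen.refl
  | tail _ hadj ih => exact ih.tail hadj.1

/-- First-exit lemma (G1(a)): an open path from the origin to a vertex of sup-norm `≥ n` contains
a vertex of sup-norm exactly `n` reached by an open path inside `Λ_n`. -/
lemma reach_of_conn {n : ℕ} {ω : Config d} {x : Vertex d} (h : Conn ω 0 x) (hx : n ≤ nrm x) :
    ∃ y, nrm y = n ∧ ConnIn n ω 0 y := by
  have key : ∀ z, Conn ω 0 z →
      (nrm z ≤ n ∧ ConnIn n ω 0 z) ∨ ∃ y, nrm y = n ∧ ConnIn n ω 0 y := by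
    intro z hz
    induction hz with
    | refl => exact Or.inl ⟨by simp, Relation.ReflTransGen.refl⟩
    | @tail z' z _ hadj ih =>
      rcases ih with ⟨hz', hc⟩ | hy
      · by_cases hzn : nrm z ≤ n
        · exact Or.inl ⟨hzn, hc.tail ⟨hadj, hz', hzn⟩⟩
        · have := nrm_le_of_openAdj hadj
          exact Or.inr ⟨z', by omega, hc⟩
      · exact Or.inr hy
  rcases key x h with ⟨hxn, hc⟩ | hy
  · exact ⟨x, le_antisymm hxn hx, hc⟩
  · exact hy

/-- The events `A_n` decrease in `n` (G1(b)). -/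
lemma reach_antitone : Antitone (Reach d) := by
  refine antitone_nat_of_succ_le fun n ω hω => ?_
  obtain ⟨y, hy, hc⟩ := hω
  exact reach_of_conn (conn_of_connIn hc) (by omega)

/-- The box `Λ_m` is finite. -/
lemma finite_box (m : ℕ) : {x : Vertex d | nrm x ≤ m}.Finite := by
  refine (Set.Finite.pi (t := fun _ : Fin d => Set.Icc (-(m : ℤ)) m)
    fun _ => Set.finite_Icc _ _).subset ?_
  intro x hx
  simp only [Set.mem_setOf_eq, nrm_le_iff] at hx
  simp only [Set.mem_pi, Set.mem_univ, Set.mem_Icc, true_implies]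
  intro i
  have := hx i
  omega

/-- G1(c): `{|C(0)| = ∞} = ⋂ₙ A_n`. -/
lemma infCluster_eq_iInter : InfCluster d = ⋂ n, Reach d n := by
  ext ω
  simp only [InfCluster, Set.mem_setOf_eq, Set.mem_iInter]
  constructor
  · intro hinf n
    obtain ⟨x, hx, hxn⟩ : ∃ x ∈ cluster ω, n ≤ nrm x := by
      by_contra hcon
      push Not at hcon
      exact hinf ((finite_box n).subset fun x hx => (hcon x hx).le)
    exact reach_of_conn hx hxn
  · intro h hfin
    obtain ⟨m, hm⟩ := (hfin.image nrm).bddAbove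
    obtain ⟨y, hy, hc⟩ := h (m + 1)
    have hmem : y ∈ cluster ω := conn_of_connIn hc
    have := hm (Set.mem_image_of_mem nrm hmem)
    omega

/-! ### Measurability -/

/-- Reachability events are measurable: if every one-step event `{ω | R ω a b}` is measurable and
the vertex type is countable, so is `{ω | ReflTransGen (R ω) a b}` (a countable union over chains). -/
lemma measurableSet_reflTransGen {α : Type*} [Countable α] {Ω : Type*} [MeasurableSpace Ω]
    (R : Ω → α → α → Prop) (hR : ∀ a b, MeasurableSet {ω | R ω a b}) (a b : α) :
    MeasurableSet {ω | Relation.ReflTransGen (R ω) a b} := by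
  have hchain : ∀ (l : List α) (a : α), MeasurableSet {ω | List.IsChain (R ω) (a :: l)} := by
    intro l
    induction l with
    | nil => intro a; simp
    | cons c l ih =>
      intro a
      simp only [List.isChain_cons_cons]
      exact (hR a c).inter (ih c)
  have : {ω | Relation.ReflTransGen (R ω) a b} =
      ⋃ l : List α, {ω | List.IsChain (R ω) (a :: l) ∧
        (a :: l).getLast (List.cons_ne_nil a l) = b} := by
    ext ω
    simp only [Set.mem_setOf_eq, Set.mem_iUnion]
    constructor
    · intro h
      exact List.exists_isChain_cons_of_relationReflTransGen h
    · rintro ⟨l, hl, hlast⟩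
      exact List.relationReflTransGen_of_exists_isChain_cons l hl hlast
  rw [this]
  refine MeasurableSet.iUnion fun l => ?_
  by_cases hb : (a :: l).getLast (List.cons_ne_nil a l) = b
  · simp only [hb, and_true]
    exact hchain l a
  · simp [hb]

/-- The one-bond events `{ω | OpenAdj ω x y}` are measurable. -/
lemma measurableSet_openAdj (x y : Vertex d) : MeasurableSet {ω : Config d | OpenAdj ω x y} := by
  have : {ω : Config d | OpenAdj ω x y} = ⋃ b : Bond d,
      ⋃ (_ : (b.src = x ∧ b.tgt = y) ∨ (b.src = y ∧ b.tgt = x)), {ω | ω b = true} := by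
    ext ω
    simp only [OpenAdj, Set.mem_setOf_eq, Set.mem_iUnion, exists_prop]
    constructor
    · rintro ⟨b, hb, h⟩; exact ⟨b, h, hb⟩
    · rintro ⟨b, h, hb⟩; exact ⟨b, hb, h⟩
  rw [this]
  refine MeasurableSet.iUnion fun b => MeasurableSet.iUnion fun _ => ?_
  show MeasurableSet ((fun ω : Config d => ω b) ⁻¹' {true})
  exact (measurable_pi_apply b) (measurableSet_singleton true)

/-- The events `{ω | OpenAdjIn n ω x y}` are measurable. -/
lemma measurableSet_openAdjIn (n : ℕ) (x y : Vertex d) :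
    MeasurableSet {ω : Config d | OpenAdjIn n ω x y} := by
  have : {ω : Config d | OpenAdjIn n ω x y} =
      {ω | OpenAdj ω x y} ∩ {_ω | nrm x ≤ n ∧ nrm y ≤ n} := by
    ext ω; simp [OpenAdjIn]
  rw [this]
  exact (measurableSet_openAdj x y).inter (MeasurableSet.const _)

/-- The events `{x ↔ y}` are measurable. -/
lemma measurableSet_conn (x y : Vertex d) : MeasurableSet {ω : Config d | Conn ω x y} :=
  measurableSet_reflTransGen (fun ω => OpenAdj ω) measurableSet_openAdj x y

/-- The events `{x ↔ y inside Λ_n}` are measurable. -/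
lemma measurableSet_connIn (n : ℕ) (x y : Vertex d) :
    MeasurableSet {ω : Config d | ConnIn n ω x y} :=
  measurableSet_reflTransGen (fun ω => OpenAdjIn n ω) (measurableSet_openAdjIn n) x y

/-- The events `A_n` are measurable (G1(a)). -/
lemma measurableSet_reach (n : ℕ) : MeasurableSet (Reach d n) := by
  have : Reach d n = ⋃ y : Vertex d, ⋃ (_ : nrm y = n), {ω | ConnIn n ω 0 y} := by
    ext ω; simp [Reach]
  rw [this]
  exact MeasurableSet.iUnion fun y => MeasurableSet.iUnion fun _ => measurableSet_connIn n 0 y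

/-- The event `{|C(0)| = ∞}` is measurable (G1(c)). -/
lemma measurableSet_infCluster : MeasurableSet (InfCluster d) := by
  rw [infCluster_eq_iInter]
  exact MeasurableSet.iInter fun n => measurableSet_reach n

/-- G1(c): `P_p(A_n) → θ_d(p)` as `n → ∞` (continuity from above). -/
lemma tendsto_reach (p : unitInterval) :
    Filter.Tendsto (fun n => (percMeasure d p).real (Reach d n)) Filter.atTop (nhds (θ d p)) := by
  unfold θ
  rw [infCluster_eq_iInter]
  have h := tendsto_measure_iInter_atTop (μ := percMeasure d p)
    (fun n => (measurableSet_reach (d := d) n).nullMeasurableSet) reach_antitone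
    ⟨0, measure_ne_top _ _⟩
  simp only [measureReal_def]
  exact (ENNReal.tendsto_toReal (measure_ne_top _ _)).comp h

/-- `θ_d(p) ≤ P_p(A_n)` for every `n`. -/
lemma θ_le_reach (p : unitInterval) (n : ℕ) : θ d p ≤ (percMeasure d p).real (Reach d n) := by
  unfold θ
  rw [infCluster_eq_iInter]
  exact measureReal_mono (Set.iInter_subset _ n)

-- END BODY

end Summit.Ventures.PercRepro0
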